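import Summits.QuantumAdvantage.QuantumAdvantage.Theorems.RingLeaderElection3A

/-!
# Low-degree leader election over `𝔽₃` (B): seeds, error set, unique leader, bad set

Cell decomp-qadv, seat lens-2 («structural dichotomy: special vs generic»), generation 12 — LAND-READY tree
twin of the node `HOME/decomp-qadv-lens-2/g12/LeaderDial.lean` (node sha256 ef4b277d…; farm rc 0 · 0 sorries ·
axioms {propext, Classical.choice, Quot.sound}).  Explicit binders, no new `Prop` items; `decide` is used only on
closed `ZMod 3` literals.

`𝔽₃` LEADER ELECTION, part B: seeds, the error set, the unique leader and the bad set.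

* `errs ω` — the inputs where `elect3 ω` disagrees with `[Good]` (`mem_errs_iff`: non-good inputs all of whose
  tallies vanish); `zeroSeeds`, `tally_flipAt`, `two_mul_card_zeroSeeds_le` — the MOD-3 TOGGLING injection:
  for a non-good `x` with a beating rotation `k₀`, `σ ↦ σ Δ {k₀}` changes the tally by `±1`, so at most half
  of the seeds have vanishing tally; `card_seeds_errs_le`, `exists_good_seed3` — averaging over seed tuples;
* `fireCount3`, `fireCount3_eq_one` — off the error set of its orbit and off collisions an input has exactly
  one firing rotation; `card_bad_mul_le3` — `#{fireCount3 ≠ 1}·(n·M) ≤ 2ⁿ` from `#errs·2^t ≤ 2ⁿ`,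
  `2n²M ≤ 2^t`, `2n³M ≤ 2^ℓ`, `2ℓ ≤ n` (the FAILURE DIVISOR `M` is the new parameter: the tree's `𝔽₂`
  election has failure `1/n`, too coarse to sit below an inverse-polynomial loss);
* `exists_election3` — the parametric existence statement used by the symmetrisation law.
-/

set_option linter.dupNamespace false

noncomputable section

open scoped Classical

namespace Summit.QuantumAdvantage.QuantumAdvantage.Theorems

open Finset
open Literature.Computability.QuantumComplexity Literature.Computability.QuantumComplexity.RingHLF
open Literature.Computability.MetaComplexity Literature.Computability.MetaComplexity.Smolensky
open Summit.QuantumAdvantage.AdviceFreeQNC0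
open Summit.QuantumAdvantage.AdviceFreeQNC0.RingSymmetry
open Summit.QuantumAdvantage.AdviceFreeQNC0.LeaderElection
open Summit.QuantumAdvantage.QuantumAdvantage.Theorems.RingPeriodFold (cov covStrat covLosing
  mem_covLosing covStrat_mem_lowDeg cov_eq_covStrat ind_rot_mem')

namespace RingLeaderElection3

variable {n : ℕ}

/-- The ERROR SET of a seed tuple `ω`: the inputs on which the election polynomial disagrees with the
indicator of `Good`. [bookkeeping] -/
def errs (hn : 0 < n) (ℓ t : ℕ) (ω : Seed n t) : Finset (Fin n → Bool) :=
  univ.filter fun x => elect3 hn ℓ t ω x ≠ if Good hn ℓ x then 1 else 0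

/-- Membership in the error set: only NON-good inputs err, and they err iff all `t` tallies vanish. -/
theorem mem_errs_iff (hn : 0 < n) (ℓ t : ℕ) (ω : Seed n t) (x : Fin n → Bool) :
    x ∈ errs hn ℓ t ω ↔ ¬ Good hn ℓ x ∧ ∀ s : Fin t, tally hn ℓ (ω s) x = 0 := by
  unfold errs
  rw [mem_filter]
  simp only [mem_univ, true_and]
  by_cases hx : Good hn ℓ x
  · rw [if_pos hx, elect3_apply_of_good hn t ω hx]
    simp [hx]
  · rw [if_neg hx]
    simp only [hx, not_false_eq_true, true_and]
    constructor
    · intro h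
      by_contra hs
      exact h (elect3_apply_eq_zero hn ℓ t ω x hs)
    · intro h
      rw [(elect3_apply_eq_one_iff hn ℓ t ω x).2 h]
      decide


/-- the subsets whose tally vanishes at `x`. -/
def zeroSeeds (hn : 0 < n) (ℓ : ℕ) (x : Fin n → Bool) : Finset (Fin n → Bool) :=
  univ.filter fun σ => tally hn ℓ σ x = 0

/-- Flipping a position `k₀ ≠ 0` with `LT³_{k₀}(x) = 0` changes the tally at `x` by `+1` (if `k₀`
enters) or `−1 = +2` (if it leaves). -/
theorem tally_flipAt (hn : 0 < n) {ℓ : ℕ} {x : Fin n → Bool} {k₀ : Fin n} (hk₀ : k₀.val ≠ 0)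
    (hlt : ltPoly3 hn ℓ k₀.val x = 0) (σ : Fin n → Bool) :
    tally hn ℓ (flipAt k₀ σ) x = tally hn ℓ σ x + (if σ k₀ = true then 2 else 1) := by
  rw [tally_apply, tally_apply, ← Finset.add_sum_erase _ _ (mem_univ k₀),
    ← Finset.add_sum_erase _ _ (mem_univ k₀)]
  have hrest : ∑ k ∈ univ.erase k₀,
      (if k.val ≠ 0 ∧ flipAt k₀ σ k = true then 1 - ltPoly3 hn ℓ k.val x else 0) =
      ∑ k ∈ univ.erase k₀, (if k.val ≠ 0 ∧ σ k = true then 1 - ltPoly3 hn ℓ k.val x else 0) := by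
    refine Finset.sum_congr rfl fun k hk => ?_
    have hne : k ≠ k₀ := (mem_erase.1 hk).1
    simp only [flipAt, Function.update_of_ne hne]
  rw [hrest, hlt, sub_zero]
  have hflip : flipAt k₀ σ k₀ = !σ k₀ := by simp [flipAt]
  rw [hflip]
  cases σ k₀
  · rw [if_pos ⟨hk₀, rfl⟩, if_neg (by simp), if_neg (by simp)]; ring
  · rw [if_neg (by simp), if_pos ⟨hk₀, rfl⟩, if_pos rfl]
    have h3 : ∀ R : ZMod 3, 0 + R = 1 + R + 2 := by decide
    exact h3 _

/-- On a non-good input AT MOST half of the subsets have vanishing tally (toggling an offending position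
maps the vanishing tallies injectively to the non-vanishing ones). -/
theorem two_mul_card_zeroSeeds_le (hn : 0 < n) {ℓ : ℕ} {x : Fin n → Bool} (hx : ¬ Good hn ℓ x) :
    2 * (zeroSeeds hn ℓ x).card ≤ 2 ^ n := by
  have hx' : ∃ k₀ : Fin n, k₀.val ≠ 0 ∧ ¬ (toLex (lab hn ℓ 0 x) < toLex (lab hn ℓ k₀.val x)) := by
    by_contra h
    exact hx fun k hk => by_contra fun hlt => h ⟨k, hk, hlt⟩
  obtain ⟨k₀, hk₀, hlt⟩ := hx'
  have hlt0 : ltPoly3 hn ℓ k₀.val x = 0 := by rw [ltPoly3_apply, if_neg hlt]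
  have hc : ∀ b : Bool, ∀ R : ZMod 3, R = 0 → R + (if b = true then 2 else 1) ≠ 0 := by decide
  have hle : (zeroSeeds hn ℓ x).card ≤
      (univ.filter fun σ : Fin n → Bool => ¬ tally hn ℓ σ x = 0).card := by
    refine Finset.card_le_card_of_injOn (fun σ => flipAt k₀ σ) (fun σ hσ => ?_) (fun σ _ σ' _ h => ?_)
    · rw [mem_coe] at hσ
      unfold zeroSeeds at hσ
      rw [mem_filter] at hσ
      rw [mem_coe, mem_filter, tally_flipAt hn hk₀ hlt0]
      exact ⟨mem_univ _, hc _ _ hσ.2⟩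
    · have := congrArg (flipAt k₀) h
      rwa [flipAt_flipAt, flipAt_flipAt] at this
  have hsum := card_filter_add_card_filter_not (s := (univ : Finset (Fin n → Bool)))
    (fun σ : Fin n → Bool => tally hn ℓ σ x = 0)
  rw [card_univ, Fintype.card_fun, Fintype.card_bool, Fintype.card_fin] at hsum
  unfold zeroSeeds at hle ⊢
  omega


/-- For a non-good input, the seeds that err at it are at most a `2^{-t}` fraction. -/
theorem card_seeds_errs_le (hn : 0 < n) (ℓ t : ℕ) {x : Fin n → Bool} (hx : ¬ Good hn ℓ x) :
    (univ.filter fun ω : Seed n t => x ∈ errs hn ℓ t ω).card * 2 ^ t ≤ Fintype.card (Seed n t) := by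
  have hset : (univ.filter fun ω : Seed n t => x ∈ errs hn ℓ t ω) =
      Fintype.piFinset fun _ : Fin t => zeroSeeds hn ℓ x := by
    ext ω
    rw [mem_filter, Fintype.mem_piFinset, mem_errs_iff]
    simp only [mem_univ, true_and, zeroSeeds, mem_filter, hx, not_false_eq_true]
  rw [hset, Fintype.card_piFinset_const, ← mul_pow, Fintype.card_pi_const, Fintype.card_fun,
    Fintype.card_bool, Fintype.card_fin]
  exact Nat.pow_le_pow_left (by rw [mul_comm]; exact two_mul_card_zeroSeeds_le hn hx) t

/-- **Averaging over seeds**: some seed errs on at most a `2^{-t}` fraction of the inputs. -/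
theorem exists_good_seed3 (hn : 0 < n) (ℓ t : ℕ) :
    ∃ ω : Seed n t, (univ.filter fun x : Fin n → Bool => x ∈ errs hn ℓ t ω).card * 2 ^ t ≤ 2 ^ n := by
  have key : ∀ x : Fin n → Bool,
      (univ.filter fun ω : Seed n t => x ∈ errs hn ℓ t ω).card * 2 ^ t ≤ Fintype.card (Seed n t) := by
    intro x
    by_cases hx : Good hn ℓ x
    · have h0 : (univ.filter fun ω : Seed n t => x ∈ errs hn ℓ t ω) = ∅ := by
        refine filter_false_of_mem fun ω _ => ?_
        rw [mem_errs_iff]; exact fun h => h.1 hx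
      rw [h0, card_empty, zero_mul]; exact Nat.zero_le _
    · exact card_seeds_errs_le hn ℓ t hx
  have hswap : ∑ ω : Seed n t, (univ.filter fun x : Fin n → Bool => x ∈ errs hn ℓ t ω).card =
      ∑ x : Fin n → Bool, (univ.filter fun ω : Seed n t => x ∈ errs hn ℓ t ω).card := by
    simp only [card_filter]
    exact Finset.sum_comm
  have htot : ∑ ω : Seed n t, (univ.filter fun x : Fin n → Bool => x ∈ errs hn ℓ t ω).card * 2 ^ t ≤
      ∑ _ω : Seed n t, 2 ^ n := by
    rw [← Finset.sum_mul, hswap, Finset.sum_mul]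
    calc ∑ x : Fin n → Bool, (univ.filter fun ω : Seed n t => x ∈ errs hn ℓ t ω).card * 2 ^ t
        ≤ ∑ _x : Fin n → Bool, Fintype.card (Seed n t) := sum_le_sum fun x _ => key x
      _ = ∑ _ω : Seed n t, 2 ^ n := by
          rw [sum_const, sum_const, card_univ, card_univ, smul_eq_mul, smul_eq_mul,
            Fintype.card_fun, Fintype.card_bool, Fintype.card_fin, mul_comm]
  obtain ⟨ω, _, hω⟩ := exists_le_of_sum_le (univ_nonempty (α := Seed n t)) htot
  exact ⟨ω, hω⟩

/-! ### The unique leader and the bad set -/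

/-- firing count of the covariant map generated by `e : CubeFn (ZMod 3) n`: the number of rotations of
`x` at which `e` reads `1`. -/
def fireCount3 (e : CubeFn (ZMod 3) n) (x : Fin n → Bool) : ℕ :=
  (univ.filter fun b : Fin n => e (rot b.val x) = 1).card

/-- If no rotation of `x` is an error input of the seed and no two windows of `x` coincide, the election
polynomial fires at EXACTLY ONE rotation of `x` (tree `good_rot_iff`, `card_isMin_eq_one`). -/
theorem fireCount3_eq_one (hn : 0 < n) {ℓ t : ℕ} {ω : Seed n t} {x : Fin n → Bool}
    (hE : ∀ b : Fin n, ¬ rot b.val x ∈ errs hn ℓ t ω) (hC : ¬ Collide hn ℓ x) :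
    fireCount3 (elect3 hn ℓ t ω) x = 1 := by
  unfold fireCount3
  have e : (univ.filter fun b : Fin n => elect3 hn ℓ t ω (rot b.val x) = 1) =
      univ.filter fun b : Fin n => IsMin hn ℓ x b := by
    refine filter_congr fun b _ => ?_
    have h : elect3 hn ℓ t ω (rot b.val x) = if Good hn ℓ (rot b.val x) then 1 else 0 := by
      have := hE b
      unfold errs at this
      rw [mem_filter, not_and] at this
      exact not_not.1 (this (mem_univ _))
    rw [h, ← good_rot_iff]
    by_cases hg : Good hn ℓ (rot b.val x) <;> simp [hg]
  rw [e, card_isMin_eq_one hn hC]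


/-- The bad set of the election polynomial, with an extra failure divisor `M`:
`#{x : fireCount3 ≠ 1}·(n·M) ≤ 2ⁿ` once `#Err·2^t ≤ 2ⁿ`, `2n²M ≤ 2^t`, `2n³M ≤ 2^ℓ`, `2ℓ ≤ n`. -/
theorem card_bad_mul_le3 (hn : 0 < n) {ℓ t M : ℕ} (h2l : 2 * ℓ ≤ n) (ht : 2 * n ^ 2 * M ≤ 2 ^ t)
    (hl : 2 * n ^ 3 * M ≤ 2 ^ ℓ) {ω : Seed n t}
    (hω : (univ.filter fun x : Fin n → Bool => x ∈ errs hn ℓ t ω).card * 2 ^ t ≤ 2 ^ n) :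
    (univ.filter fun x : Fin n → Bool => fireCount3 (elect3 hn ℓ t ω) x ≠ 1).card * (n * M) ≤
      2 ^ n := by
  set U₁ := univ.filter fun x : Fin n → Bool => ∃ b : Fin n, rot b.val x ∈ errs hn ℓ t ω with hU₁
  set U₂ := univ.filter fun x : Fin n → Bool => Collide hn ℓ x with hU₂
  have hsub : (univ.filter fun x : Fin n → Bool => fireCount3 (elect3 hn ℓ t ω) x ≠ 1) ⊆ U₁ ∪ U₂ := by
    intro x hx
    rw [mem_filter] at hx
    rw [mem_union, hU₁, hU₂, mem_filter, mem_filter]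
    by_contra h
    have h1 : ∀ b : Fin n, ¬ rot b.val x ∈ errs hn ℓ t ω :=
      fun b hb => h (Or.inl ⟨mem_univ _, b, hb⟩)
    have h2 : ¬ Collide hn ℓ x := fun hc => h (Or.inr ⟨mem_univ _, hc⟩)
    exact hx.2 (fireCount3_eq_one hn h1 h2)
  have hU₁le : U₁.card * 2 ^ t ≤ n * 2 ^ n := by
    have hsub1 : U₁ ⊆ (univ : Finset (Fin n)).biUnion fun b =>
        univ.filter fun x : Fin n → Bool => rot b.val x ∈ errs hn ℓ t ω := by
      intro x hx
      rw [hU₁, mem_filter] at hx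
      obtain ⟨b, hb⟩ := hx.2
      rw [mem_biUnion]
      exact ⟨b, mem_univ _, mem_filter.2 ⟨mem_univ _, hb⟩⟩
    calc U₁.card * 2 ^ t
        ≤ (∑ b : Fin n, (univ.filter fun x : Fin n → Bool => rot b.val x ∈ errs hn ℓ t ω).card) *
            2 ^ t := Nat.mul_le_mul_right _ ((card_le_card hsub1).trans card_biUnion_le)
      _ = (∑ _b : Fin n, (univ.filter fun x : Fin n → Bool => x ∈ errs hn ℓ t ω).card) * 2 ^ t := by
          congr 1
          exact sum_congr rfl fun b _ => card_filter_rot b.val (fun x => x ∈ errs hn ℓ t ω)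
      _ = n * ((univ.filter fun x : Fin n → Bool => x ∈ errs hn ℓ t ω).card * 2 ^ t) := by
          rw [sum_const, card_univ, Fintype.card_fin, smul_eq_mul, Nat.mul_assoc]
      _ ≤ n * 2 ^ n := Nat.mul_le_mul_left _ hω
  have hU₂le : U₂.card * 2 ^ ℓ ≤ n ^ 2 * 2 ^ n := card_collide hn h2l
  have h1 : U₁.card * (2 * n * M) ≤ 2 ^ n := by
    have : U₁.card * (2 * n ^ 2 * M) ≤ n * 2 ^ n := (Nat.mul_le_mul_left _ ht).trans hU₁le
    have e : U₁.card * (2 * n ^ 2 * M) = (U₁.card * (2 * n * M)) * n := by ring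
    rw [e, Nat.mul_comm n] at this
    exact Nat.le_of_mul_le_mul_right this hn
  have h2 : U₂.card * (2 * n * M) ≤ 2 ^ n := by
    have : U₂.card * (2 * n ^ 3 * M) ≤ n ^ 2 * 2 ^ n := (Nat.mul_le_mul_left _ hl).trans hU₂le
    have e : U₂.card * (2 * n ^ 3 * M) = (U₂.card * (2 * n * M)) * n ^ 2 := by ring
    rw [e, Nat.mul_comm (n ^ 2)] at this
    exact Nat.le_of_mul_le_mul_right this (by positivity)
  have h3 : (univ.filter fun x : Fin n → Bool => fireCount3 (elect3 hn ℓ t ω) x ≠ 1).card *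
      (2 * n * M) ≤ 2 * 2 ^ n := by
    calc (univ.filter fun x : Fin n → Bool => fireCount3 (elect3 hn ℓ t ω) x ≠ 1).card * (2 * n * M)
        ≤ (U₁ ∪ U₂).card * (2 * n * M) := Nat.mul_le_mul_right _ (card_le_card hsub)
      _ ≤ (U₁.card + U₂.card) * (2 * n * M) := Nat.mul_le_mul_right _ (card_union_le _ _)
      _ = U₁.card * (2 * n * M) + U₂.card * (2 * n * M) := Nat.add_mul _ _ _
      _ ≤ 2 ^ n + 2 ^ n := Nat.add_le_add h1 h2
      _ = 2 * 2 ^ n := by ring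
  have e : (univ.filter fun x : Fin n → Bool => fireCount3 (elect3 hn ℓ t ω) x ≠ 1).card *
      (2 * n * M) =
      2 * ((univ.filter fun x : Fin n → Bool => fireCount3 (elect3 hn ℓ t ω) x ≠ 1).card *
        (n * M)) := by ring
  rw [e] at h3
  exact Nat.le_of_mul_le_mul_left h3 (by norm_num)

/-- **`𝔽₃` leader election, parametric form**: for window length `ℓ`, `t` trials and failure divisor `M`
with `2ℓ ≤ n`, `2n²M ≤ 2^t`, `2n³M ≤ 2^ℓ`, a `{0,1}`-valued polynomial of degree `≤ 4tℓ` fires at exactly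
one rotation of all but `2ⁿ/(nM)` patterns. -/
theorem exists_election3 (hn : 0 < n) {ℓ t M : ℕ} (h2l : 2 * ℓ ≤ n) (ht : 2 * n ^ 2 * M ≤ 2 ^ t)
    (hl : 2 * n ^ 3 * M ≤ 2 ^ ℓ) :
    ∃ e : CubeFn (ZMod 3) n, e ∈ lowDeg (ZMod 3) n (t * (2 * (2 * ℓ))) ∧ (∀ y, e y = 0 ∨ e y = 1) ∧
      (univ.filter fun x : Fin n → Bool => fireCount3 e x ≠ 1).card * (n * M) ≤ 2 ^ n := by
  obtain ⟨ω, hω⟩ := exists_good_seed3 hn ℓ t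
  exact ⟨elect3 hn ℓ t ω, elect3_mem hn ℓ t ω, elect3_zero_or_one hn ℓ t ω,
    card_bad_mul_le3 hn h2l ht hl hω⟩

end RingLeaderElection3

end Summit.QuantumAdvantage.QuantumAdvantage.Theorems
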